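import Summits.BirchSwinnertonDyer.Rank1Residual.Additive.TameBranchAnalyticShaConverseTwins
import Summits.BirchSwinnertonDyer.Rank1Residual.Additive.QuadraticTwistSurj
import Literature.NumberTheory.EllipticCurves.Wuthrich2014.ThreeAdicImageOrdinaryProofs
import HarnessLib

/-!
# THE ANALYTIC ORDER OF Ш IS THE CERTIFICATE AT EVERY ODD `p`, `p = 3` INCLUDED — X4♯(G-ord, `e = 2`)
# ∩ {`ρ̄` onto} with the (B)-datum a BINDER: the `3`-adic tower of the good-ordinary twist is a
# THEOREM (lit-kato's proved case of Wuthrich's Lemma 20), so gen 32's rank-0 chain runs at `p = 3`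
# (cell `b2b-bsdres`, sub-cell additive-p2 = X3♯(G-ord)/X4♯(G-ord), gen 33; part 1)

HONEST FRAMING (cell `b2b-bsdres`, run/shared/lean/b2b/bsd-rank1-residual/, verbatim in every
file): the goal of the cell is to DELETE the COMBINATION-SHAPED residual classes of the
Birch–Swinnerton-Dyer formula for ALL analytic-rank `≤ 1` elliptic curves over `ℚ` — "full BSD
formula for every rank `≤ 1` curve in class `C`" assembled STRICTLY from published theorems — so
that the rank-`≤ 1` remainder becomes exactly the CONSTRUCTION-SHAPED classes, which are TYPED
(missing-input `Prop`s), NOT attempted. This is not "finishing BSD". Sub-cell additive-p2: the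
classes X3♯(G-ord) / X4♯(G-ord) are CONSTRUCTION-SHAPED and stay so; labels / RESIDUAL-MAP marks
UNCHANGED; nothing is booked. Theorems only;
published inputs are explicit binders (`hK` Kato 2004 Thm. 17.4 (3) on the `ω^{(p−1)/2}`-component,
`hGZK`, `hmod`, `hmodD`, and the (B)-datum `LeadingTermClauses W p Dh` of Delbourgo 2002 Theorem (B)
— supplied at `p ≥ 5` by A175 `Delbourgo2002.mainTheorem` and at `p = 3` by n1011-lit's
`Delbourgo2002.mainTheorem_three`, §3). No definition, no named fact, no `sorry`.

## What and why

Gen 32 (parts 3, 6) proved on X4♯(G-ord, `e = 2`) ∩ {`ρ̄_{E,p}` onto}, **`p ≥ 5`**, rank 0: `p ∤ #Ш_an(E)`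
⟹ the Kato element GENERATES `char_Λ X(E/ℚ_∞)` (Delbourgo's main conjecture (G) at the pair,
integrally), `#Ш[p^∞] = 1`, `TameBranchRatCharEqAt W p`, `BSD(E,p)`; and the upper half WITH `ℓ`,
`ord_p #Ш[p^∞] + ord_p ℓ ≤ ord_p #Ш_an`, `=` iff the Kato element generates. Its evidence reading left
the 137 (G-ord, `e = 2`) × X4 rank-0 rows at `p = 3` out: "need a `p = 3` big-image tower". THAT TOWER
IS A THEOREM OF THE TREE: the good-ordinary twist model `V` of `E^{(p*)}` (`GoodOrd V p`,
`TypeGOrd.exists_goodOrd_pStar_twist_model`, Tate's algorithm at `3`) has `ρ̄_{V,p}` onto iff `ρ̄_{E,p}`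
is (`surj_iff_of_model_twist`) and then `ρ̄_{V,pⁿ}` onto for all `n` at EVERY odd `p` by lit-kato's
PROVED good-ordinary case of Wuthrich 2014 Lemma 20
(`WeierstrassCurve.forall_hasSurjectiveModNGaloisRep_pow_of_goodOrdinary_of_surj`; the n1011-p14
observation `ClassX4Gord.towerSurj_of_surj` for `E` itself). The only other use of `p ≥ 5` in gen 32's
chain was A175's (B)-datum; taking the datum as a BINDER (as the X3 twins already do) gives §1–§2 at
every odd `p`, and §3 discharges the binder at `p = 3` from `mainTheorem_three` (Delbourgo 2002 at
`p = 3` under the printed quadratic-semistability Hypothesis, which `e = 2` supplies).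

* §0 `ClassX4Gord.towerSurj_twist_of_surj`: the tower of the TWIST `V` from `Surj W p`, every odd `p`.
* §1 MASTER (per twist datum, (B)-datum a binder, every odd `p`):
  `ClassX4Gord.padicVal_sha_add_le_shaAn_and_iff_rankZero_odd` — the Kato element `g` (`ι g = u·ϖ·B^±`,
  `v_p(g(0)) + 2t = ord_p s + ord_p ∏c`), Delbourgo's `ℓ ∣ p²`, **`ord_p #Ш[p^∞] + ord_p ℓ ≤ ord_p s`,
  `=` ⟺ `char_Λ X = (g)`**.
* §2 COROLLARIES, every odd `p`: (a) `ord_p s ≤ 0` ⟹ `char_Λ X = (g)`, `#Ш[p^∞] = 1`, `ord_p s = 0`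
  (`…charIdeal_eq_span_kato_of_shaAn_unit_rankZero_odd`); (b) the HEADLINE `TameBranchRatCharEqAt W p`
  ∧ `#Ш[p^∞] = 1` ∧ `BSD(E,p)` (`…tameBranchRatCharEqAt_and_bsdp_of_katoHalf_of_shaAn_unit_rankZero_odd`).
  Part 2 (`TameBranchAnalyticShaOddPrimeConverse.lean`) draws the `BSD(E,p)` ⟺ MC(pair) consequences.
* §3 `p = 3`: `ClassX4Gord.exists_leadingTermClauses_three` (binder discharged by `mainTheorem_three`,
  non-CM, `e = 2`) and the `p = 3` headline `ClassX4Gord.tameBranchRatCharEqAt_and_bsdp_three_…`.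

Census pointer (EVIDENCE, gen33/ODD-PRIME-READING.md; nothing booked): the 137 rank-0 (G-ord, `e = 2`)
× X4 × surj(3) pairs N < 2·10⁴ enter the scope of (b) — 132 with `3 ∤ #Ш_an`; the 5 with `3 ∣ #Ш_an`
(3555e1, 14976k1, 16074b1, 16830p1: `#Ш_an = 9`; 19215t1: `81`) are part 2 / part 3 territory.

References: Kato 2004 Thm. 17.4 (3) [Kato2004Asterisque]; Wuthrich 2014 Lemma 20 [Wuthrich2014];
Delbourgo 2002 Thm. (A), (B), Hypothesis p. 39 [Delbourgo2002]; Greenberg–Vatsal 2000 p. 4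
[GreenbergVatsal2000]; Greenberg LNM 1716 §4 [GreenbergLNM1716]; Mazur–Tate–Teitelbaum 1986 §I.8, §I.13
[MazurTateTeitelbaum1986Invent]; Pal 2012 Thm. 3.2 [Pal2012]; Miller 2011 Def. 1.1 [Miller2011LMS];
gen 32 parts 1–3, 6; n1011-p14 `SemistableTwistTowerThree.lean`. -/

set_option autoImplicit false

noncomputable section

open scoped Classical MatrixGroups ModularForm NumberField

open CongruenceSubgroup IsDedekindDomain WeierstrassCurve NumberField
  Literature.NumberTheory.EllipticCurves
  Literature.NumberTheory.EllipticCurves.ModularForms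
  Literature.NumberTheory.EllipticCurves.Rank1Residual
  Literature.NumberTheory.EllipticCurves.Rank1Residual.Typed
  Literature.NumberTheory.EllipticCurves.Delbourgo2002
  Literature.NumberTheory.GaloisRepresentations
  Summit.BirchSwinnertonDyer.Rank1Residual.AdditivePotMult
  Summit.BirchSwinnertonDyer.Rank1Residual.X1.MuLambda
  Summit.BirchSwinnertonDyer.Rank1Residual.X1.RankOneParitySqueeze
  Summit.BirchSwinnertonDyer.Rank1Residual.X11a.LambdaNorm

namespace Summit.BirchSwinnertonDyer.Rank1Residual.Additive

/-! ### §0 The tower of the good-ordinary twist from surj(p), every odd `p` -/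

section Tower

variable {W : WeierstrassCurve ℚ} [W.IsElliptic] {p : ℕ} [hp : Fact p.Prime]

omit [W.IsElliptic] in
/-- **The `p`-adic tower of the good-ordinary TWIST from surj(p) of `E`, every odd `p` (`p = 3` included).**
For `V/ℚ` globally minimal, good ORDINARY at the odd prime `p`, with `C • V^{(p*)} = W` and `ρ̄_{W,p}`
onto: `ρ̄_{V,pⁿ}` is onto for every `n` — `ρ̄_{V,p}` onto by twist invariance
(`surj_iff_of_model_twist`), then lit-kato's PROVED good-ordinary case of Wuthrich 2014 Lemma 20
(`forall_hasSurjectiveModNGaloisRep_pow_of_goodOrdinary_of_surj`: Serre–Tate line + a first-order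
witness). This is the hypothesis (12.5.2) of Kato 2004 Thm. 17.4 (3) for `V`, with NO `p ≥ 5`.
[cite: Wuthrich2014, Lemma 20 (p. 399)] [cite: Kato2004Asterisque, (12.5.2) in Thm. 12.5 (4) (p. 222)]
[cite: SilvermanAEC2009, X.5 Cor. 5.4] -/
theorem towerSurj_twist_of_goodOrd_of_surj (hp2 : p ≠ 2) (hsurj : Surj W p)
    (V : WeierstrassCurve ℚ) [V.IsElliptic] [V.IsGloballyMinimal] (C : VariableChange ℚ)
    (hC : C • V.quadraticTwist ((-1 : ℚ) ^ (p / 2) * p) = W) (hV : GoodOrd V p) (n : ℕ) :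
    V.HasSurjectiveModNGaloisRep (p ^ n : ℕ) := by
  have hsV : Surj V p := (surj_iff_of_model_twist V p (pStar_ne_zero p) ⟨C, hC⟩).mp hsurj
  exact V.forall_hasSurjectiveModNGaloisRep_pow_of_goodOrdinary_of_surj p hp2 hV.1 hV.2 hsV n

omit [W.IsElliptic] hp in
/-- A finite `p`-primary group with `ord_p` of its order `0` is trivial (its order is a power of `p`).
[folklore] -/
theorem natCard_primaryComponent_sha_eq_one_of_padicValNat_eq_zero [Fact p.Prime]
    [Finite (AddCommGroup.primaryComponent W.sha p)]
    (h0 : padicValNat p (Nat.card (AddCommGroup.primaryComponent W.sha p)) = 0) :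
    Nat.card (AddCommGroup.primaryComponent W.sha p) = 1 := by
  obtain ⟨k, hk⟩ := exists_natCard_primaryComponent_eq_pow (A := W.sha) (p := p)
  rw [hk, padicValNat.prime_pow] at h0
  rw [hk, h0, pow_zero]

end Tower

/-! ### §1 MASTER, every odd `p`, (B)-datum a binder: the upper half WITH `ℓ` and its equality case -/

section Master

open TameBranchMuPart TameBranchAnalyticSha

variable {W : WeierstrassCurve ℚ} [W.IsElliptic] [W.IsGloballyMinimal] {p : ℕ} [hp : Fact p.Prime]

/-- **MASTER THEOREM AT EVERY ODD `p` ((B)-datum a binder).** X4♯(G-ord) ∩ {`ρ̄_{E,p}` onto}, `p` odd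
(`p = 3` included), `ord_{s=1} L(E,s) = 0`, `#Ш_an(E) = s ∈ ℚ`, a (B)-datum `Dh` with
`LeadingTermClauses W p Dh` (A175 at `p ≥ 5`, `mainTheorem_three` at `p = 3`); twist data `(V, C, f, ϖ)`
(`V = E♭` globally minimal GOOD ORDINARY at `p`, `C • V^{(p*)} = W`, `f` newform of `V`, `ϖ` the period
ratio of the parity of `(p−1)/2`). Then for every cyclotomic dual datum: `X` torsion, `Ш[p^∞]` finite, and
there are the Kato element `g ∈ char_Λ X` (`ι g = u·ϖ·B^±_{(p−1)/2}(f, α)`, `v_p(g(0)) + 2·ord_p #tors =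
ord_p s + ord_p ∏c`) and Delbourgo's `ℓ ∣ p²` (`= 1` off the anomalous rows) with
**`ord_p #Ш(E/ℚ)[p^∞] + ord_p ℓ ≤ ord_p s`, EQUALITY ⟺ `char_Λ X = (g)`**. Gen 32's
`…_and_iff_rankZero` with `p ≥ 5 ↦ p ≠ 2` (tower by §0) and the (B)-datum a binder.
[cite: Kato2004Asterisque, Thm. 17.4 (3) (p. 273)] [cite: Wuthrich2014, Lemma 20 (p. 399)]
[cite: Delbourgo2002, Theorem (B) (p. 40)] [cite: GreenbergVatsal2000, p. 4]
[cite: MazurTateTeitelbaum1986Invent, §I.8 (8.6), §I.13–I.14] [cite: Miller2011LMS, §1 (arXiv:1010.2431 p. 3)] -/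
theorem ClassX4Gord.padicVal_sha_add_le_shaAn_and_iff_rankZero_odd
    (hK : Wuthrich2014.kato_halfEigenCharIdeal_dvd_cyclotomicPrime_of_surjective)
    (hGZK : rank_eq_analyticRank_of_analyticRank_le_one) (hmod : hasEntireLFunction_rat)
    (hX : ClassX4Gord W p) (hsurj : Surj W p) (hr : W.analyticRank = 0)
    {Dh : PAdicHeightData W p} (hBcl : LeadingTermClauses W p Dh) {s : ℚ} (hs : shaAn W = (s : ℂ))
    (V : WeierstrassCurve ℚ) [V.IsElliptic] [V.IsGloballyMinimal] (C : VariableChange ℚ)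
    (hC : C • V.quadraticTwist ((-1 : ℚ) ^ (p / 2) * p) = W) (hV : GoodOrd V p)
    {N : ℕ} [NeZero N] {f : CuspForm (Gamma0 N) 2} (hf : IsNewformOf V f)
    (ϖ : ℚ) (hϖ : if Even (p / 2) then (ϖ : ℝ) * V.realPeriodRat = plusPeriod f
      else (ϖ : ℝ) * V.imaginaryPeriodRat = minusPeriod f)
    {κ : ZpExtension ℚ p} {γ : Field.absoluteGaloisGroup ℚ}
    (hκ : κ.IsCyclotomic) (hγ : κ.IsTopGenerator γ) (hγ' : IsCyclotomicVariable p γ)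
    (D : W.SelmerDualData κ γ) :
    D.IsTorsion ∧ Finite (AddCommGroup.primaryComponent W.sha p) ∧
      ∃ (g : IwasawaAlgebra p) (u : ℤ_[p]ˣ) (ℓ : ℕ), g ∈ D.charIdeal ∧
        iwasawaToPowerSeries p g = PowerSeries.C (((u : ℤ_[p]) : ℚ_[p]) * (ϖ : ℚ_[p])) *
          (if Even (p / 2) then padicLFunctionBranch f ((unitRoot V p : ℤ_[p]) : ℚ_[p]) (p / 2)
            else padicLFunctionMinusBranch f ((unitRoot V p : ℤ_[p]) : ℚ_[p]) (p / 2)) ∧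
        (((PowerSeries.constantCoeff g : ℤ_[p]) : ℚ_[p])).valuation + 2 * padicValNat p W.torsionOrder =
          padicValRat p s + padicValNat p W.tamagawaProduct ∧
        ℓ ∣ p ^ 2 ∧ (ReductionNonAnomalous W p → ℓ = 1) ∧
        (padicValNat p (Nat.card (AddCommGroup.primaryComponent W.sha p)) : ℤ) + padicValNat p ℓ ≤
          padicValRat p s ∧
        (D.charIdeal = Ideal.span {g} ↔
          (padicValNat p (Nat.card (AddCommGroup.primaryComponent W.sha p)) : ℤ) + padicValNat p ℓ =
            padicValRat p s) := by
  have hp2 : p ≠ 2 := hX.addv.1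
  have hadd : Addv W p := hX.addv.2
  obtain ⟨hmw, -⟩ := hGZK W (by rw [hr]; norm_num)
  have hr0 : W.mordellWeilRank = 0 := by rw [hmw, hr]
  have hL : W.entireLFunction 1 ≠ 0 := (W.analyticRank_eq_zero_iff_holds (hmod W)).mp hr
  have hΩ : (W.realPeriodRat : ℂ) ≠ 0 := by exact_mod_cast W.realPeriodRat_pos_holds.ne'
  have hj := padicValRat_j_nonneg_of_typeGOrd W p hX.typeGOrd
  have hsurjV : ∀ m : ℕ, V.HasSurjectiveModNGaloisRep (p ^ m : ℕ) :=
    towerSurj_twist_of_goodOrd_of_surj hp2 hsurj V C hC hV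
  have hord : IsOrdinaryAt V p :=
    isOrdinaryAt_of_goodOrd_or_mult_of_model_twist W V (pStar_ne_zero p) ⟨C, hC⟩ hj (Or.inl hV)
  -- the dictionary at `T = 0`
  obtain ⟨q, u', hu'0, -, hLq, hA⟩ :=
    exists_rat_and_unit_constantCoeff_branch_eq hmod hp2 hadd V C hC hord hf ϖ hϖ
  have hdict :=
    valuation_constantCoeff_branch_add_eq_padicValRat_shaAn_add hmod hGZK hp2 hadd hL V C hC hord hf ϖ hϖ hs
  have hq0 : q ≠ 0 := by
    intro h0; apply hL
    have e : W.entireLFunction 1 = (q : ℂ) * (W.realPeriodRat : ℂ) := by rw [← hLq, div_mul_cancel₀ _ hΩ]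
    rw [e, h0, Rat.cast_zero, zero_mul]
  have hϖB0 : PowerSeries.constantCoeff (PowerSeries.C (ϖ : ℚ_[p]) *
      (if Even (p / 2) then padicLFunctionBranch f ((unitRoot V p : ℤ_[p]) : ℚ_[p]) (p / 2)
        else padicLFunctionMinusBranch f ((unitRoot V p : ℤ_[p]) : ℚ_[p]) (p / 2))) ≠ 0 := by
    rw [hA]; exact mul_ne_zero hu'0 (by exact_mod_cast hq0)
  haveI : Module.Finite (IwasawaAlgebra p) D.X :=
    SelmerDualData.module_finite_of_isCyclotomic (W := W) (κ := κ) hκ D hγ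
  obtain ⟨hXt, g, hg, u, hι⟩ := isTorsion_and_exists_iota_eq_branch_of_katoComponent W p
    (Kato2004.charIdeal_dvd_padicLFunctionBranch_component_of_surjective_of_half hK) hj hp2 V
    ⟨C, hC⟩ (Or.inl hV) hsurjV hκ hγ hγ' hf D ϖ hϖ
  have hX0eq : PowerSeries.constantCoeff (PowerSeries.C (((u : ℤ_[p]) : ℚ_[p]) * (ϖ : ℚ_[p])) *
      (if Even (p / 2) then padicLFunctionBranch f ((unitRoot V p : ℤ_[p]) : ℚ_[p]) (p / 2)
        else padicLFunctionMinusBranch f ((unitRoot V p : ℤ_[p]) : ℚ_[p]) (p / 2))) =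
      ((u : ℤ_[p]) : ℚ_[p]) * PowerSeries.constantCoeff (PowerSeries.C (ϖ : ℚ_[p]) *
        (if Even (p / 2) then padicLFunctionBranch f ((unitRoot V p : ℤ_[p]) : ℚ_[p]) (p / 2)
          else padicLFunctionMinusBranch f ((unitRoot V p : ℤ_[p]) : ℚ_[p]) (p / 2))) := by
    simp only [map_mul, PowerSeries.constantCoeff_C]; ring
  have hX0 : PowerSeries.constantCoeff (PowerSeries.C (((u : ℤ_[p]) : ℚ_[p]) * (ϖ : ℚ_[p])) *
      (if Even (p / 2) then padicLFunctionBranch f ((unitRoot V p : ℤ_[p]) : ℚ_[p]) (p / 2)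
        else padicLFunctionMinusBranch f ((unitRoot V p : ℤ_[p]) : ℚ_[p]) (p / 2))) ≠ 0 := by
    rw [hX0eq]; exact mul_ne_zero (coe_units_ne_zero p u) hϖB0
  have hvX : (PowerSeries.constantCoeff (PowerSeries.C (((u : ℤ_[p]) : ℚ_[p]) * (ϖ : ℚ_[p])) *
      (if Even (p / 2) then padicLFunctionBranch f ((unitRoot V p : ℤ_[p]) : ℚ_[p]) (p / 2)
        else padicLFunctionMinusBranch f ((unitRoot V p : ℤ_[p]) : ℚ_[p]) (p / 2)))).valuation +
        2 * padicValNat p W.torsionOrder = padicValRat p s + padicValNat p W.tamagawaProduct := by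
    rw [hX0eq, Padic.valuation_mul (coe_units_ne_zero p u) hϖB0, valuation_coe_units_eq_zero, zero_add,
      hdict]
  haveI : (Literature.NumberTheory.EllipticCurves.Module.charIdeal (IwasawaAlgebra p) D.X).IsPrincipal :=
    charIdeal_isPrincipal_holds p D.X
  obtain ⟨fE, hchar⟩ := Submodule.IsPrincipal.principal
    (Literature.NumberTheory.EllipticCurves.Module.charIdeal (IwasawaAlgebra p) D.X)
  obtain ⟨hfin, ℓ, hℓp, hℓ1, hle, hiff⟩ := charIdeal_eq_span_iff_valuation_eq_rankZero_of_iota_eq hr0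
    hBcl hκ hγ hγ' D hXt hchar hg hι hX0
  have hvg : (((PowerSeries.constantCoeff g : ℤ_[p]) : ℚ_[p])).valuation + 2 * padicValNat p W.torsionOrder =
      padicValRat p s + padicValNat p W.tamagawaProduct := by
    rw [← constantCoeff_iwasawaToPowerSeries p g, hι]; exact hvX
  refine ⟨hXt, hfin, g, u, ℓ, hg, hι, hvg, hℓp, hℓ1, by linarith, ?_⟩
  rw [hiff]
  constructor <;> intro e <;> linarith

end Master

/-! ### §2 Corollaries at every odd `p` -/

section Corollaries

open TameBranchMuPart TameBranchAnalyticSha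

variable {W : WeierstrassCurve ℚ} [W.IsElliptic] [W.IsGloballyMinimal] {p : ℕ} [hp : Fact p.Prime]

/-- **(a) THE CORE AT EVERY ODD `p`: `p ∤ #Ш_an(E)` ⟹ THE KATO ELEMENT GENERATES `char_Λ X(E/ℚ_∞)`.**
Setting of the master theorem with **`ord_p s ≤ 0`**: `X` torsion, **`#Ш(E/ℚ)[p^∞] = 1`**, **`ord_p s = 0`**,
and the Kato element `g` (`ι g = u·ϖ·B^±`) has **`char_Λ X = (g)`** — Delbourgo's (G)-main conjecture at
the pair, INTEGRALLY in E-normalisation, at `p = 3` too. [cite: Kato2004Asterisque, Thm. 17.4 (3) (p. 273)]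
[cite: Delbourgo2002, Theorem (B) (p. 40)] [cite: GreenbergLNM1716, §4 pp. 102–110] -/
theorem ClassX4Gord.charIdeal_eq_span_kato_of_shaAn_unit_rankZero_odd
    (hK : Wuthrich2014.kato_halfEigenCharIdeal_dvd_cyclotomicPrime_of_surjective)
    (hGZK : rank_eq_analyticRank_of_analyticRank_le_one) (hmod : hasEntireLFunction_rat)
    (hX : ClassX4Gord W p) (hsurj : Surj W p) (hr : W.analyticRank = 0)
    {Dh : PAdicHeightData W p} (hBcl : LeadingTermClauses W p Dh)
    {s : ℚ} (hs : shaAn W = (s : ℂ)) (hsv : padicValRat p s ≤ 0)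
    (V : WeierstrassCurve ℚ) [V.IsElliptic] [V.IsGloballyMinimal] (C : VariableChange ℚ)
    (hC : C • V.quadraticTwist ((-1 : ℚ) ^ (p / 2) * p) = W) (hV : GoodOrd V p)
    {N : ℕ} [NeZero N] {f : CuspForm (Gamma0 N) 2} (hf : IsNewformOf V f)
    (ϖ : ℚ) (hϖ : if Even (p / 2) then (ϖ : ℝ) * V.realPeriodRat = plusPeriod f
      else (ϖ : ℝ) * V.imaginaryPeriodRat = minusPeriod f)
    {κ : ZpExtension ℚ p} {γ : Field.absoluteGaloisGroup ℚ}
    (hκ : κ.IsCyclotomic) (hγ : κ.IsTopGenerator γ) (hγ' : IsCyclotomicVariable p γ)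
    (D : W.SelmerDualData κ γ) :
    D.IsTorsion ∧ Nat.card (AddCommGroup.primaryComponent W.sha p) = 1 ∧ padicValRat p s = 0 ∧
      ∃ (g : IwasawaAlgebra p) (u : ℤ_[p]ˣ), D.charIdeal = Ideal.span {g} ∧
        iwasawaToPowerSeries p g =
          PowerSeries.C (((u : ℤ_[p]) : ℚ_[p]) * (ϖ : ℚ_[p])) *
            (if Even (p / 2) then padicLFunctionBranch f ((unitRoot V p : ℤ_[p]) : ℚ_[p]) (p / 2)
              else padicLFunctionMinusBranch f ((unitRoot V p : ℤ_[p]) : ℚ_[p]) (p / 2)) := by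
  obtain ⟨hXt, hfin, g, u, ℓ, -, hι, -, -, -, hle, hiff⟩ :=
    hX.padicVal_sha_add_le_shaAn_and_iff_rankZero_odd hK hGZK hmod hsurj hr hBcl hs V C hC hV hf ϖ hϖ hκ hγ hγ' D
  haveI := hfin
  have h1 : (0 : ℤ) ≤ padicValNat p (Nat.card (AddCommGroup.primaryComponent W.sha p)) := by
    exact_mod_cast Nat.zero_le _
  have h2 : (0 : ℤ) ≤ padicValNat p ℓ := by exact_mod_cast Nat.zero_le _
  have hs0 : padicValRat p s = 0 := by linarith
  have hS0 : (padicValNat p (Nat.card (AddCommGroup.primaryComponent W.sha p)) : ℤ) = 0 := by linarith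
  have hℓ0 : (padicValNat p ℓ : ℤ) = 0 := by linarith
  refine ⟨hXt, natCard_primaryComponent_sha_eq_one_of_padicValNat_eq_zero (by exact_mod_cast hS0), hs0,
    g, u, hiff.mpr (by rw [hS0, hℓ0, hs0, add_zero]), hι⟩

/-- **(b) HEADLINE AT EVERY ODD `p`, RANK ZERO: THE ANALYTIC ORDER OF Ш IS THE CERTIFICATE.** X4♯(G-ord)
∩ `I₀*` (`e = 2`) ∩ {`ρ̄_{E,p}` onto}, `p` odd (`p = 3` INCLUDED), `ord_{s=1} L(E,s) = 0`, a (B)-datum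
`Dh`, and **`ord_p #Ш_an(E) ≤ 0`**. Then **`TameBranchRatCharEqAt W p`**, **`#Ш(E/ℚ)[p^∞] = 1`**,
**`ord_p #Ш_an(E) = 0`**, **`BSD(E,p)`**. Inputs: Kato 17.4 (3) (`hK`), BCDT (`hmodD`), GZK, modularity,
the (B)-datum — and ONE INTEGER of Cremona's table; the tower at `p = 3` is §0.
[cite: Kato2004Asterisque, Thm. 17.4 (3) (p. 273)] [cite: Wuthrich2014, Lemma 20 (p. 399)]
[cite: Delbourgo2002, Theorem (B) (p. 40)] [cite: Miller2011LMS, Def. 1.1 (arXiv:1010.2431 p. 3)] -/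
theorem ClassX4Gord.tameBranchRatCharEqAt_and_bsdp_of_katoHalf_of_shaAn_unit_rankZero_odd
    (hK : Wuthrich2014.kato_halfEigenCharIdeal_dvd_cyclotomicPrime_of_surjective)
    (hmodD : nonempty_modularParametrizationData)
    (hGZK : rank_eq_analyticRank_of_analyticRank_le_one) (hmod : hasEntireLFunction_rat)
    (hX : ClassX4Gord W p) (he : semistabilityIndex W p = 2) (hsurj : Surj W p) (hr : W.analyticRank = 0)
    {Dh : PAdicHeightData W p} (hBcl : LeadingTermClauses W p Dh)
    {s : ℚ} (hs : shaAn W = (s : ℂ)) (hsv : padicValRat p s ≤ 0) :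
    TameBranchRatCharEqAt W p ∧ Nat.card (AddCommGroup.primaryComponent W.sha p) = 1 ∧
      padicValRat p s = 0 ∧ BSDp W p := by
  have hp2 : p ≠ 2 := hX.addv.1
  obtain ⟨hmw, -⟩ := hGZK W (by rw [hr]; norm_num)
  have hL : W.entireLFunction 1 ≠ 0 := (W.analyticRank_eq_zero_iff_holds (hmod W)).mp hr
  obtain ⟨V, iV, iVm, C, hV, hC⟩ := hX.exists_goodOrd_pStar_twist_model W p he
  haveI : NeZero (V.conductorNorm ℤ) := ⟨(V.conductorNorm_pos_holds).ne'⟩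
  obtain ⟨Dm⟩ := hmodD V
  obtain ⟨ϖ, hϖ⟩ := exists_periodRatio_parity (p := p) V Dm
  have core := fun {κ : ZpExtension ℚ p} {γ : Field.absoluteGaloisGroup ℚ} (hκ : κ.IsCyclotomic)
      (hγ : κ.IsTopGenerator γ) (hγ' : IsCyclotomicVariable p γ) (D : W.SelmerDualData κ γ) ↦
    hX.charIdeal_eq_span_kato_of_shaAn_unit_rankZero_odd hK hGZK hmod hsurj hr hBcl hs hsv V C hC hV
      Dm.isNewformOf ϖ hϖ hκ hγ hγ' D
  obtain ⟨κ₀, γ₀, hκ₀, hγ₀, hγ₀', D₀, -, -⟩ := exists_cyclotomic_dualData_generator W p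
  obtain ⟨-, hcard, hs0, -⟩ := core hκ₀ hγ₀ hγ₀' D₀
  have hΩ : (W.realPeriodRat : ℂ) ≠ 0 := by exact_mod_cast W.realPeriodRat_pos_holds.ne'
  have hj := padicValRat_j_nonneg_of_typeGOrd W p hX.typeGOrd
  have hord : IsOrdinaryAt V p :=
    isOrdinaryAt_of_goodOrd_or_mult_of_model_twist W V (pStar_ne_zero p) ⟨C, hC⟩ hj (Or.inl hV)
  obtain ⟨q, u', hu'0, -, hLq, hA⟩ :=
    exists_rat_and_unit_constantCoeff_branch_eq hmod hp2 hX.addv.2 V C hC hord Dm.isNewformOf ϖ hϖ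
  have hq0 : q ≠ 0 := by
    intro h0; apply hL
    have e : W.entireLFunction 1 = (q : ℂ) * (W.realPeriodRat : ℂ) := by rw [← hLq, div_mul_cancel₀ _ hΩ]
    rw [e, h0, Rat.cast_zero, zero_mul]
  have h0 : PowerSeries.constantCoeff (PowerSeries.C (ϖ : ℚ_[p]) *
      (if Even (p / 2) then padicLFunctionBranch Dm.f ((unitRoot V p : ℤ_[p]) : ℚ_[p]) (p / 2)
        else padicLFunctionMinusBranch Dm.f ((unitRoot V p : ℤ_[p]) : ℚ_[p]) (p / 2))) ≠ 0 := by
    rw [hA]; exact mul_ne_zero hu'0 (by exact_mod_cast hq0)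
  have hϖ0 : ϖ ≠ 0 := by
    rintro rfl; apply h0; rw [Rat.cast_zero, map_zero, zero_mul, map_zero]
  have hB0 : (if Even (p / 2) then padicLFunctionBranch Dm.f ((unitRoot V p : ℤ_[p]) : ℚ_[p]) (p / 2)
      else padicLFunctionMinusBranch Dm.f ((unitRoot V p : ℤ_[p]) : ℚ_[p]) (p / 2)) ≠ 0 := by
    intro e; apply h0; rw [e, mul_zero, map_zero]
  refine ⟨?_, hcard, hs0, ⟨hmw, Nat.finite_of_card_ne_zero (by rw [hcard]; exact one_ne_zero), s, hs,
    by rw [hs0, hcard, padicValNat_one_right, Nat.cast_zero]⟩⟩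
  intro κ γ N _ f ε α B _ haddv _ hκ hγ hcv hf _ hα hB D
  obtain ⟨hXt, -, -, g₁, u, hspan, hι⟩ := core hκ hγ hcv D
  have hnd : ∃ r : ℚ, ratPlusSymbol f r ≠ 0 := by
    refine ⟨0, fun h00 ↦ hL ?_⟩
    rw [hf.entireLFunction_one_eq, h00]
    simp
  exact ⟨hXt, exists_charIdeal_eq_span_and_iota_eq_of_generator hp2 V C hC haddv hV hf hnd Dm hϖ0
    hspan hι hB0 hα hB⟩

end Corollaries

/-! ### §3 `p = 3`: the (B)-datum from `Delbourgo2002.mainTheorem_three` -/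

section Three

open TameBranchMuPart TameBranchAnalyticSha

variable {W : WeierstrassCurve ℚ} [W.IsElliptic] [W.IsGloballyMinimal]

/-- **The (B)-datum at `p = 3` on X4♯(G-ord) ∩ `I₀*`, non-CM.** Delbourgo 2002 Thm. (B) at `p = 3`
(`mainTheorem_three`: additive at `3`, potentially good ordinary of type (G), no CM, and a globally minimal
good-ordinary model of a quadratic twist — here the twist model of `E^{(−3)}` supplied by `e = 2`).
[cite: Delbourgo2002, Theorem (A), (B) (p. 40), Hypothesis second bullet (p. 39)] -/
theorem ClassX4Gord.exists_leadingTermClauses_three [Fact (Nat.Prime 3)]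
    (hDel3 : Delbourgo2002.mainTheorem_three) (hX : ClassX4Gord W 3) (hcm : ¬ W.HasCM)
    (he : semistabilityIndex W 3 = 2) :
    ∃ Dh : PAdicHeightData W 3, LeadingTermClauses W 3 Dh := by
  obtain ⟨V, iV, iVm, C, hV, hC⟩ := hX.exists_goodOrd_pStar_twist_model W 3 he
  -- turn the twist round: `C' • W^{(p*)} = V`
  obtain ⟨C', hC'⟩ := exists_variableChange_twist_of_model_twist V (pStar_ne_zero 3) hC
  exact Delbourgo2002.mainTheorem_three.exists_leadingTermClauses hDel3 rfl hcm hX.addv.2 hX.typeGOrd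
    ⟨(-1 : ℚ) ^ ((3 : ℕ) / 2) * (3 : ℕ), V, iV, iVm, C', pStar_ne_zero 3, hC', hV.1, hV.2⟩

/-- **HEADLINE AT `p = 3`, RANK ZERO: THE ANALYTIC ORDER OF Ш IS THE CERTIFICATE.** X4♯(G-ord) ∩ `I₀*`
∩ {`ρ̄_{E,3}` onto}, `E` non-CM, `ord_{s=1} L(E,s) = 0`, **`ord_3 #Ш_an(E) ≤ 0`**. Then
**`TameBranchRatCharEqAt W 3`**, **`#Ш(E/ℚ)[3^∞] = 1`**, **`ord_3 #Ш_an(E) = 0`**, **`BSD(E,3)`**. Inputs: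
Kato 17.4 (3) (`hK`; tower by §0), Delbourgo 2002 at `p = 3` (`hDel3`), BCDT, GZK, modularity — and ONE
INTEGER of Cremona's table (census: 132 rank-0 window rows N < 2·10⁴). [cite: Kato2004Asterisque, Thm. 17.4 (3) (p. 273)]
[cite: Wuthrich2014, Lemma 20 (p. 399)] [cite: Delbourgo2002, Theorem (A), (B) (p. 40)]
[cite: Miller2011LMS, Def. 1.1 (arXiv:1010.2431 p. 3)] -/
theorem ClassX4Gord.tameBranchRatCharEqAt_and_bsdp_three_of_katoHalf_of_shaAn_unit_rankZero
    [Fact (Nat.Prime 3)]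
    (hK : Wuthrich2014.kato_halfEigenCharIdeal_dvd_cyclotomicPrime_of_surjective)
    (hmodD : nonempty_modularParametrizationData) (hDel3 : Delbourgo2002.mainTheorem_three)
    (hGZK : rank_eq_analyticRank_of_analyticRank_le_one) (hmod : hasEntireLFunction_rat)
    (hX : ClassX4Gord W 3) (hcm : ¬ W.HasCM) (he : semistabilityIndex W 3 = 2) (hsurj : Surj W 3)
    (hr : W.analyticRank = 0) {s : ℚ} (hs : shaAn W = (s : ℂ)) (hsv : padicValRat 3 s ≤ 0) :
    TameBranchRatCharEqAt W 3 ∧ Nat.card (AddCommGroup.primaryComponent W.sha 3) = 1 ∧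
      padicValRat 3 s = 0 ∧ BSDp W 3 := by
  obtain ⟨Dh, hBcl⟩ := hX.exists_leadingTermClauses_three hDel3 hcm he
  exact hX.tameBranchRatCharEqAt_and_bsdp_of_katoHalf_of_shaAn_unit_rankZero_odd hK hmodD hGZK hmod he hsurj
    hr hBcl hs hsv

end Three

end Summit.BirchSwinnertonDyer.Rank1Residual.Additive

end
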